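import Literature.Computability.ImplicitComplexity.SoftTypeAssignmentSubst
import HarnessLib

/-!
# `STA` soft types: the σ-calculus of type renaming/substitution, and type substitution in contexts

Companion to `SoftTypeAssignment.lean` (the systems `STA`/`STA₊` of Gaboardi–Marion–Ronchi Della
Rocca 2008 = GMR08, de Bruijn form). The typing rules `(∀I)`/`(∀E)` manipulate type variables
(`STA.Ctx.shift`, `STA.LinTy.inst`); every structural result on derivations (closure of typing
under type substitution, the generation lemma behind subject reduction, GMR08 §3 / GR07) needs the
algebra of these operations, collected here:

* σ-calculus identities for `STA.LinTy.rename` / `STA.LinTy.substp` (`rename_rename`,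
  `substp_rename`, `rename_substp`, `substp_substp`, `substp_tvar`) and the laws of the
  instantiation `B[A/α]` of rule `(∀E)` (`inst_rename`, `inst_substp`);
* type substitution in soft types and contexts, `STA.SoftTy.substT`, `STA.Ctx.substT` (the
  operation `Γ[A/α]` of GR07's substitution-on-derivations lemma), renaming of type variables
  `STA.SoftTy.renameT`, `STA.Ctx.renameT` (so that `Ctx.shift = Ctx.renameT Nat.succ`), and their
  commutation with the context operations of the rules (`cons`, `Function.update`, `bang`,
  `mpx`, `shift`, `Split`, `IsSingleton`).

Everything is folklore de Bruijn bookkeeping; no typing derivation is touched in this file.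

## References

* [GaboardiMarionRonchidellarocca2008] GMR08, Def. 3.1 (iii) (soft types), Table 2 (`(∀I)`,
  `(∀E)`), §3 ("σ[A/α] … preserves the correct syntax of types").
* [GaboardiRonchiDellaRocca2007] M. Gaboardi, S. Ronchi Della Rocca, *A Soft Type Assignment
  System for λ-Calculus*, CSL 2007 (substitution of types in derivations).
-/

namespace Literature.Computability.ImplicitComplexity

namespace STA

namespace LinTy

/-! ### Renaming and substitution of type variables -/

/-- Renaming by the identity does nothing. [folklore] -/
theorem rename_id (A : LinTy) : A.rename id = A := by
  induction A with
  | tvar i => rfl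
  | limp k B C ihB ihC => simp [LinTy.rename, ihB, ihC]
  | all B ih => simp [LinTy.rename, liftRen_id, ih]

/-- Two renamings compose. [folklore] -/
theorem rename_rename (A : LinTy) (ρ₁ ρ₂ : ℕ → ℕ) :
    (A.rename ρ₁).rename ρ₂ = A.rename (ρ₂ ∘ ρ₁) := by
  induction A generalizing ρ₁ ρ₂ with
  | tvar i => rfl
  | limp k B C ihB ihC => simp [LinTy.rename, ihB, ihC]
  | all B ih => simp [LinTy.rename, ih, liftRen_comp]

/-- Lifting a substitution after a lifted renaming. [folklore] -/
theorem up_comp_liftRen (τ : ℕ → LinTy) (ρ : ℕ → ℕ) : LinTy.up τ ∘ liftRen ρ = LinTy.up (τ ∘ ρ) := by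
  funext i
  cases i <;> rfl

/-- Substituting into a renamed type. [folklore] -/
theorem substp_rename (A : LinTy) (ρ : ℕ → ℕ) (τ : ℕ → LinTy) :
    (A.rename ρ).substp τ = A.substp (τ ∘ ρ) := by
  induction A generalizing ρ τ with
  | tvar i => rfl
  | limp k B C ihB ihC => simp [LinTy.rename, LinTy.substp, ihB, ihC]
  | all B ih => simp [LinTy.rename, LinTy.substp, ih, up_comp_liftRen]

/-- Renaming a lifted substitution by a lifted renaming. [folklore] -/
theorem up_rename (τ : ℕ → LinTy) (ρ : ℕ → ℕ) :
    (fun i => (LinTy.up τ i).rename (liftRen ρ)) = LinTy.up (fun i => (τ i).rename ρ) := by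
  funext i
  cases i with
  | zero => rfl
  | succ i =>
    show ((τ i).rename Nat.succ).rename (liftRen ρ) = ((τ i).rename ρ).rename Nat.succ
    rw [rename_rename, rename_rename]
    rfl

/-- Renaming a substituted type. [folklore] -/
theorem rename_substp (A : LinTy) (τ : ℕ → LinTy) (ρ : ℕ → ℕ) :
    (A.substp τ).rename ρ = A.substp (fun i => (τ i).rename ρ) := by
  induction A generalizing τ ρ with
  | tvar i => rfl
  | limp k B C ihB ihC => simp [LinTy.rename, LinTy.substp, ihB, ihC]
  | all B ih =>
    simp only [LinTy.rename, LinTy.substp]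
    rw [ih, up_rename]

/-- Lifting commutes with composition of substitutions. [folklore] -/
theorem up_substp (τ₁ τ₂ : ℕ → LinTy) :
    (fun i => (LinTy.up τ₁ i).substp (LinTy.up τ₂)) = LinTy.up (fun i => (τ₁ i).substp τ₂) := by
  funext i
  cases i with
  | zero => rfl
  | succ i =>
    show ((τ₁ i).rename Nat.succ).substp (LinTy.up τ₂) = ((τ₁ i).substp τ₂).rename Nat.succ
    rw [substp_rename, rename_substp]
    rfl

/-- Two substitutions compose. [folklore] -/
theorem substp_substp (A : LinTy) (τ₁ τ₂ : ℕ → LinTy) :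
    (A.substp τ₁).substp τ₂ = A.substp (fun i => (τ₁ i).substp τ₂) := by
  induction A generalizing τ₁ τ₂ with
  | tvar i => rfl
  | limp k B C ihB ihC => simp [LinTy.substp, ihB, ihC]
  | all B ih =>
    simp only [LinTy.substp]
    rw [ih, up_substp]

/-- Lifting the identity substitution is the identity substitution. [folklore] -/
theorem up_tvar : LinTy.up LinTy.tvar = LinTy.tvar := by
  funext i
  cases i <;> rfl

/-- The identity substitution does nothing. [folklore] -/
theorem substp_tvar (A : LinTy) : A.substp LinTy.tvar = A := by
  induction A with
  | tvar i => rfl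
  | limp k B C ihB ihC => simp [LinTy.substp, ihB, ihC]
  | all B ih => simp [LinTy.substp, up_tvar, ih]

/-- A renaming is the substitution of variables for variables. [folklore] -/
theorem rename_eq_substp (A : LinTy) (ρ : ℕ → ℕ) : A.rename ρ = A.substp (fun i => .tvar (ρ i)) := by
  have h := substp_rename A ρ LinTy.tvar
  rw [substp_tvar] at h
  exact h

/-- Substituting for the variable just introduced by a shift recovers the type: `(A↑)[B/α] = A`.
[folklore] -/
theorem inst_rename_succ (A B : LinTy) : (A.rename Nat.succ).inst B = A := by
  unfold inst
  rw [substp_rename]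
  exact substp_tvar A

/-- Instantiation commutes with renaming: `(B[A/α])ρ = (B (⇑ρ))[Aρ/α]`. [folklore] -/
theorem inst_rename (B A : LinTy) (ρ : ℕ → ℕ) :
    (B.inst A).rename ρ = (B.rename (liftRen ρ)).inst (A.rename ρ) := by
  unfold inst
  rw [rename_substp, substp_rename]
  congr 1
  funext i
  cases i <;> rfl

/-- Instantiation commutes with substitution: `(B[A/α])θ = (B (⇑θ))[Aθ/α]` — the law making
rule `(∀E)` stable under type substitution. [folklore] -/
theorem inst_substp (B A : LinTy) (θ : ℕ → LinTy) :
    (B.inst A).substp θ = (B.substp (LinTy.up θ)).inst (A.substp θ) := by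
  unfold inst
  rw [substp_substp, substp_substp]
  congr 1
  funext i
  cases i with
  | zero => rfl
  | succ i =>
    show θ i = ((θ i).rename Nat.succ).substp _
    rw [substp_rename]
    exact (substp_tvar (θ i)).symm

/-- A shifted type followed by a lifted substitution is the substituted type, shifted — the law
making rule `(∀I)` stable under type substitution. [folklore] -/
theorem substp_up_rename_succ (A : LinTy) (θ : ℕ → LinTy) :
    (A.rename Nat.succ).substp (LinTy.up θ) = (A.substp θ).rename Nat.succ := by
  rw [substp_rename, rename_substp]
  rfl

/-- A shifted type followed by a lifted renaming is the renamed type, shifted. [folklore] -/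
theorem rename_liftRen_rename_succ (A : LinTy) (ρ : ℕ → ℕ) :
    (A.rename Nat.succ).rename (liftRen ρ) = (A.rename ρ).rename Nat.succ := by
  rw [rename_rename, rename_rename]
  rfl

end LinTy

/-! ### Type substitution and type renaming in soft types and contexts -/

/-- `σ[θ]`: substitute linear types for the free type variables of a soft type (the number of `!`
is unchanged). [cite: GaboardiMarionRonchidellarocca2008, §3 (substitution preserves soft types)] -/
def SoftTy.substT (θ : ℕ → LinTy) (σ : SoftTy) : SoftTy := ⟨σ.bangs, σ.lin.substp θ⟩

/-- Rename the free type variables of a soft type. [folklore] -/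
def SoftTy.renameT (ρ : ℕ → ℕ) (σ : SoftTy) : SoftTy := ⟨σ.bangs, σ.lin.rename ρ⟩

/-- `Γ[θ]`: type substitution in every assumption of a context. [cite: GaboardiRonchiDellaRocca2007, §3 (substitution in derivations)] -/
def Ctx.substT (θ : ℕ → LinTy) (Γ : Ctx) : Ctx := fun i => (Γ i).map (SoftTy.substT θ)

/-- Rename the free type variables of every assumption of a context. [folklore] -/
def Ctx.renameT (ρ : ℕ → ℕ) (Γ : Ctx) : Ctx := fun i => (Γ i).map (SoftTy.renameT ρ)

/-- `SoftTy.shift` is renaming by `succ`. [folklore] -/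
theorem SoftTy.shift_eq_renameT (σ : SoftTy) : σ.shift = σ.renameT Nat.succ := rfl

/-- `Ctx.shift` is renaming by `succ`. [folklore] -/
theorem Ctx.shift_eq_renameT (Γ : Ctx) : Γ.shift = Γ.renameT Nat.succ := rfl

/-- Type renaming is type substitution by variables. [folklore] -/
theorem SoftTy.renameT_eq_substT (ρ : ℕ → ℕ) (σ : SoftTy) :
    σ.renameT ρ = σ.substT (fun i => .tvar (ρ i)) := by
  simp [SoftTy.renameT, SoftTy.substT, LinTy.rename_eq_substp]

/-- Type renaming of contexts is type substitution by variables. [folklore] -/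
theorem Ctx.renameT_eq_substT (ρ : ℕ → ℕ) (Γ : Ctx) :
    Γ.renameT ρ = Γ.substT (fun i => .tvar (ρ i)) := by
  funext i
  simp only [Ctx.renameT, Ctx.substT]
  congr 1
  funext σ
  exact SoftTy.renameT_eq_substT ρ σ

/-- `(!σ)[θ] = !(σ[θ])`. [folklore] -/
theorem SoftTy.substT_bang (θ : ℕ → LinTy) (σ : SoftTy) : (σ.bang).substT θ = (σ.substT θ).bang := rfl

/-- `(!ᵏA)[θ] = !ᵏ(A[θ])` on the pair encoding. [folklore] -/
theorem SoftTy.substT_mk (θ : ℕ → LinTy) (k : ℕ) (A : LinTy) :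
    SoftTy.substT θ ⟨k, A⟩ = ⟨k, A.substp θ⟩ := rfl

/-- Shifting then substituting a lifted substitution is substituting then shifting. [folklore] -/
theorem SoftTy.substT_up_shift (θ : ℕ → LinTy) (σ : SoftTy) :
    (σ.shift).substT (LinTy.up θ) = (σ.substT θ).shift := by
  simp [SoftTy.shift, SoftTy.substT, LinTy.substp_up_rename_succ]

namespace Ctx

/-- `(Γ[θ]) i = (Γ i)[θ]`. [folklore] -/
@[simp] theorem substT_apply (θ : ℕ → LinTy) (Γ : Ctx) (i : ℕ) : Γ.substT θ i = (Γ i).map (SoftTy.substT θ) := rfl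

/-- Type substitution commutes with extending a context by a new slot. [folklore] -/
theorem substT_cons (θ : ℕ → LinTy) (a : Option SoftTy) (Γ : Ctx) :
    (Ctx.cons a Γ).substT θ = Ctx.cons (a.map (SoftTy.substT θ)) (Γ.substT θ) := by
  funext i
  cases i <;> rfl

/-- Type substitution commutes with updating a slot. [folklore] -/
theorem substT_update (θ : ℕ → LinTy) (Γ : Ctx) (j : ℕ) (a : Option SoftTy) :
    Ctx.substT θ (Function.update Γ j a) = Function.update (Γ.substT θ) j (a.map (SoftTy.substT θ)) := by
  funext i
  by_cases h : i = j
  · subst h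
    simp
  · simp [Function.update_of_ne h]

/-- Type substitution commutes with `!Γ`. [folklore] -/
theorem substT_bang (θ : ℕ → LinTy) (Γ : Ctx) : (Γ.bang).substT θ = (Γ.substT θ).bang := by
  funext i
  simp only [substT_apply, Ctx.bang, Option.map_map]
  rfl

/-- Type substitution commutes with the multiplexor's context operation. [folklore] -/
theorem substT_mpx (θ : ℕ → LinTy) (Γ : Ctx) (S : Finset ℕ) (j : ℕ) (σ : SoftTy) :
    (Γ.mpx S j σ).substT θ = (Γ.substT θ).mpx S j (σ.substT θ) := by
  funext i
  by_cases hS : i ∈ S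
  · simp [Ctx.mpx, hS]
  · by_cases hj : i = j
    · subst hj
      simp [Ctx.mpx, hS, SoftTy.substT_bang]
    · simp [Ctx.mpx, hS, hj]

/-- Type substitution by a lifted substitution commutes with the type-variable shift of `(∀I)`.
[folklore] -/
theorem substT_up_shift (θ : ℕ → LinTy) (Γ : Ctx) :
    (Γ.shift).substT (LinTy.up θ) = (Γ.substT θ).shift := by
  funext i
  simp only [substT_apply, Ctx.shift, Option.map_map]
  congr 1
  funext σ
  exact SoftTy.substT_up_shift θ σ

/-- The empty context is invariant under type substitution. [folklore] -/
theorem substT_empty (θ : ℕ → LinTy) : Ctx.empty.substT θ = Ctx.empty := rfl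

/-- A split of contexts stays a split after type substitution. [folklore] -/
theorem Split.substT {Γ Γ₁ Γ₂ : Ctx} (h : Γ.Split Γ₁ Γ₂) (θ : ℕ → LinTy) :
    (Γ.substT θ).Split (Γ₁.substT θ) (Γ₂.substT θ) := by
  intro i
  rcases h i with ⟨h₁, h₂⟩ | ⟨h₁, h₂⟩
  · exact Or.inl ⟨by simp [h₁], by simp [h₂]⟩
  · exact Or.inr ⟨by simp [h₁], by simp [h₂]⟩

/-- A singleton context stays a singleton after type substitution. [folklore] -/
theorem IsSingleton.substT {Γ : Ctx} {i : ℕ} {σ : SoftTy} (h : Γ.IsSingleton i σ) (θ : ℕ → LinTy) :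
    (Γ.substT θ).IsSingleton i (σ.substT θ) :=
  ⟨by simp [h.1], fun j hj => by simp [h.2 j hj]⟩

end Ctx

end STA

end Literature.Computability.ImplicitComplexity
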